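import Mathlib
import Summits.Ventures.PercRepro2.Defs
import Summits.Ventures.PercRepro2.Graph
import Summits.Ventures.PercRepro2.Harris
import Summits.Ventures.PercRepro2.RowC1Cross

/-!
# The cross term of row 2′C1 at an `a₂b`-edge: the two-mass form (blind cell PercRepro2, p2 g34;
proofs/P2-G34-ROOT.md §11)

At an edge `e = a₂b` opening `e` puts `b ∈ H`, so `P¹(Q, bH) = P¹(Q)` and `P¹(Q, oU, bU) = P¹(Q, oU)`,
and the cross term collapses to

  `c1Cross p e = P¹(Q, oU)·(P⁰(Q) − P⁰(Q, bH)) − P¹(Q)·(P⁰(Q, oU) − P⁰(Q, oU, bU))`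
              `= P¹(Q, oU)·P⁰(Q, b ∉ H) − P¹(Q)·P⁰(Q, o ∈ U, b ∉ U)`   (`c1Cross_eq_of_a₂b_edge`),

so `CrossNonneg` at an `a₂b`-edge is the two-world statement
`P(o ∈ U | Q, e open) ≥ P(o ∈ U, b ∉ U | Q, b ∉ H, e closed)` (kit j334695: CROSS ≥ 0 on
89,171 / 89,171 `a₂b`-edges; the sign-agreement criterion fails on 12,269 of them, so this is the form
to attack).  Std axioms.
-/

namespace Summit.Ventures.PercRepro2

namespace RowC1

section A2B

variable {V : Type*} {E : Type*} [Fintype E] [DecidableEq E] [Fintype V] [DecidableEq V]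
  {R : Type*} [Field R] [LinearOrder R] [IsStrictOrderedRing R]

omit [Fintype V] [DecidableEq V] in
/-- Under `p[e↦1]` with `e = a₂b`, `b ∈ H` is sure on `Q`: `P¹(Q, bH) = P¹(Q)`. -/
lemma prob_update_one_bHQ_eq_Q (p : E → R) (hp : IsProbVec p) (ends : E → Sym2 V) {e : E}
    {a₂ b : V} (hends : ends e = s(a₂, b)) (a₁ : V) :
    prob (Function.update p e (1 : R)) (connEvent ends a₂ b ∩ (connEvent ends a₁ a₂)ᶜ) =
      prob (Function.update p e (1 : R)) (connEvent ends a₁ a₂)ᶜ := by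
  have hp' := hp.update e zero_le_one le_rfl
  refine le_antisymm (prob_mono hp' Set.inter_subset_right) ?_
  calc prob (Function.update p e (1 : R)) (connEvent ends a₁ a₂)ᶜ
      = prob (Function.update p e (1 : R)) ((connEvent ends a₁ a₂)ᶜ ∩ openEdge e) :=
        (prob_update_one_inter_openEdge p _ e).symm
    _ ≤ prob (Function.update p e (1 : R)) (connEvent ends a₂ b ∩ (connEvent ends a₁ a₂)ᶜ) := by
        apply prob_mono hp'
        rintro ω ⟨hQ, he⟩
        exact ⟨conn_of_openAdj ⟨e, he, hends⟩, hQ⟩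

omit [Fintype V] [DecidableEq V] in
/-- Under `p[e↦1]` with `e = a₂b`, `b ∈ U` is sure: `P¹(Q, oU, bU) = P¹(Q, oU)`. -/
lemma prob_update_one_oUbUQ_eq_oUQ' (p : E → R) (hp : IsProbVec p) (ends : E → Sym2 V) {e : E}
    {a₂ b : V} (hends : ends e = s(a₂, b)) (a₁ o : V) :
    prob (Function.update p e (1 : R))
        ((connEvent ends a₁ o ∪ connEvent ends a₂ o) ∩
          (connEvent ends a₁ b ∪ connEvent ends a₂ b) ∩ (connEvent ends a₁ a₂)ᶜ) =
      prob (Function.update p e (1 : R))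
        ((connEvent ends a₁ o ∪ connEvent ends a₂ o) ∩ (connEvent ends a₁ a₂)ᶜ) := by
  have hp' := hp.update e zero_le_one le_rfl
  refine le_antisymm (prob_mono hp' ?_) ?_
  · rintro ω ⟨⟨hoU, _⟩, hQ⟩
    exact ⟨hoU, hQ⟩
  · calc prob (Function.update p e (1 : R))
          ((connEvent ends a₁ o ∪ connEvent ends a₂ o) ∩ (connEvent ends a₁ a₂)ᶜ)
        = prob (Function.update p e (1 : R))
            (((connEvent ends a₁ o ∪ connEvent ends a₂ o) ∩ (connEvent ends a₁ a₂)ᶜ) ∩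
              openEdge e) := (prob_update_one_inter_openEdge p _ e).symm
      _ ≤ _ := by
        apply prob_mono hp'
        rintro ω ⟨⟨hoU, hQ⟩, he⟩
        exact ⟨⟨hoU, Or.inr (conn_of_openAdj ⟨e, he, hends⟩)⟩, hQ⟩

omit [Fintype V] [DecidableEq V] in
/-- **The cross term at an `a₂b`-edge**:
`c1Cross p e = P¹(Q, oU)·(P⁰(Q) − P⁰(Q, bH)) − P¹(Q)·(P⁰(Q, oU) − P⁰(Q, oU, bU))`. -/
theorem c1Cross_eq_of_a₂b_edge (p : E → R) (hp : IsProbVec p) (ends : E → Sym2 V) {e : E}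
    {a₂ b : V} (hends : ends e = s(a₂, b)) (a₁ o : V) :
    c1Cross p ends a₁ a₂ o b e =
      prob (Function.update p e (1 : R))
          ((connEvent ends a₁ o ∪ connEvent ends a₂ o) ∩ (connEvent ends a₁ a₂)ᶜ) *
        (prob (Function.update p e (0 : R)) (connEvent ends a₁ a₂)ᶜ -
          prob (Function.update p e (0 : R)) (connEvent ends a₂ b ∩ (connEvent ends a₁ a₂)ᶜ)) -
      prob (Function.update p e (1 : R)) (connEvent ends a₁ a₂)ᶜ *
        (prob (Function.update p e (0 : R))
            ((connEvent ends a₁ o ∪ connEvent ends a₂ o) ∩ (connEvent ends a₁ a₂)ᶜ) -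
          prob (Function.update p e (0 : R))
            ((connEvent ends a₁ o ∪ connEvent ends a₂ o) ∩
              (connEvent ends a₁ b ∪ connEvent ends a₂ b) ∩ (connEvent ends a₁ a₂)ᶜ)) := by
  unfold c1Cross
  rw [prob_update_one_bHQ_eq_Q p hp ends hends a₁, prob_update_one_oUbUQ_eq_oUQ' p hp ends hends a₁ o]
  ring

end A2B

end RowC1

end Summit.Ventures.PercRepro2
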